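import Literature.Analysis.FluidPDE.SereginSverakOffAxisRegularity
import Literature.Analysis.FluidPDE.SereginZajaczkowski2007Lemma23Tools
import Literature.Analysis.FluidPDE.PressureDecayEstimateProofs
import HarnessLib

/-!
# Seregin–Šverák 2009, (as15) (`UnitScaleOffAxisBound`): assembly from Seregin–Zajaczkowski 2007,
# Cor. 4.4 and Seregin 2014, Lemma 6.1

Proofs-only file (no definitions) closing the reduction of the named fact
`SereginSverak2009.UnitScaleOffAxisBound` (`SereginSverakOffAxisScaling.lean`: the bound (as15) of
the proof of Seregin–Šverák 2009, Prop. 3.7, arXiv:0804.1803 p. 10 = Seregin–Zajaczkowski 2007,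
Prop. 4.1, (4.1), for the rescaled Type I axially symmetric pairs) begun in
`SereginSverakOffAxisInputs.lean` / `SereginSverakOffAxisTools.lean` / `SereginSverakOffAxisEpsilon.lean`
(`unitScaleOffAxisBound_of_inputs : OffAxisL6Bound → OffAxisSmoothRepresentative →
seregin_sverak_pressure_decay → lemarieRieusset_epsilon_regularity → UnitScaleOffAxisBound`). Two of
those four inputs are now theorems — `seregin_sverak_pressure_decay_holds`
(`PressureDecayEstimateProofs.lean`) and `offAxisSmoothRepresentative_of`
(`SereginSverakOffAxisRegularity.lean`, from the pressure decay and Seregin 2014, Lemma 6.1) — and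
the ε-regularity step of the printed proof of SZ2007 Lemma 2.3 ("according to the so-called
ε-regularity theory … `|v(z₀)| ≤ c/r₀`", arXiv:math/0702720 p. 3) is the case `k = 0` of the same
Lemma 6.1. Hence the main result of this file:

`SereginSverak2009.unitScaleOffAxisBound_of_lemma61 :
    OffAxisL6Bound → seregin2014_lemma61 → UnitScaleOffAxisBound`,

i.e. the trust base of (as15) is reduced to Seregin–Zajaczkowski 2007, Cor. 4.4 (the `L₆` bound
for the smooth class, the energy method of SZ2007 §4) and Seregin 2014, Ch. 6, Lemma 6.1 (the
ε-regularity lemma with all derivatives = Escauriaza–Seregin–Šverák 2003, Lemma 2.2). Contents: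

* `offAxisSmoothRepresentative_of_lemma61 : seregin2014_lemma61 → OffAxisSmoothRepresentative`
  and the corresponding form of the Prop. 4.1 route,
  `unitScaleOffAxisBound_of_offAxisSupBound_of_lemma61 : OffAxisSupBound → seregin2014_lemma61 →
  UnitScaleOffAxisBound`;
* `ae_bound_of_lemma61`: the ε-regularity step in the a.e. form used by the a.e. rendering of
  (as15) — for a suitable weak solution on `Q(0,3)`, a centre `z₀ ∈ 𝒞(1,2;1) × ]-1,0[`, a scale
  `0 < ρ ≤ 1/4` with `C(ρ; z₀) + D(ρ; z₀) ≤ η < ε₀`: the class `IsSuitableWeakSolutionInBall ρ z₀`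
  (closed box in `Q̂ ⊆ Q(0,3)`, the sibling's `closedBox_subset_shellCyl_hat`), the zoom to `Q(0,1)`
  with (6.1.5) (`IsSuitableWeakSolutionInBall.zoom`, `lintegral_cube_zoom`,
  `lintegral_pressure_zoom`), Lemma 6.1, and the transport back (`exists_representative_of_zoom`,
  `k = 0`): `|u| ≤ c₀ 0 / ρ` a.e. on `Q_{ρ/2}(z₀)`;
* `unitScaleOffAxisBound_of_lemma61`: the printed proof "Applying Corollary 4.4 and Lemma 2.3"
  run as in `unitScaleOffAxisBound_of_inputs` (Hölder step `C(s²; z₀) ≤ a_K s` from the `L₆`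
  bound, the decay estimate between the scales `s_k = σ^k/2`, the majorant `decayMajorant`, the
  first index `epsIndex` with `C + D ≤ η = ε₀/2`, the countable covering of `Q¹₁(0)`), with
  `Φ(K) = max(0, c₀ 0)/ρ_K`;
* the corollaries down the accepted chain: `offAxisBound_of_lemma61` ((as14)) and
  `axisDecayBound_of_lemma61 : ScaledEnergyBound → OffAxisL6Bound → seregin2014_lemma61 →
  AxisDecayBound` (Prop. 3.7).

When `OffAxisL6Bound_holds` and `seregin2014_lemma61_holds` are available,
`theorem UnitScaleOffAxisBound_holds : UnitScaleOffAxisBound :=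
  unitScaleOffAxisBound_of_lemma61 OffAxisL6Bound_holds seregin2014_lemma61_holds`
is to be appended here.

## References

* G. Seregin, V. Šverák, Comm. PDE 34 (2009) 171–201, arXiv:0804.1803: Remark 3.4 (p. 9),
  proof of Prop. 3.7, (as14)–(as15) (p. 10). [`SereginSverak2009`]
* G. Seregin, W. Zajaczkowski, SIAM J. Math. Anal. 39 (2007), arXiv:math/0702720: proof of
  Lemma 2.3 (p. 3), Prop. 4.1, Cor. 4.4, proof of Prop. 4.1 (pp. 5–7). [`SereginZajaczkowski2007`]
* G. Seregin, *Lecture Notes on Regularity Theory for the Navier–Stokes Equations*, World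
  Scientific 2014, Ch. 6, §6.1, Lemma 6.1 (p. 90), p. 100. [`Seregin2014`]
-/

noncomputable section

open MeasureTheory Set Function Filter Topology TopologicalSpace Module Metric
open scoped NNReal ENNReal ContDiff

namespace Literature.Analysis.FluidPDE

namespace SereginSverak2009

open SereginZajaczkowski2007

variable {u : ℝ → EuclideanSpace ℝ (Fin 3) → EuclideanSpace ℝ (Fin 3)} {p : ℝ → EuclideanSpace ℝ (Fin 3) → ℝ}

/-! ### Unconditional forms of the off-axis regularity -/

/-- **`OffAxisSmoothRepresentative` from Seregin 2014, Lemma 6.1 alone**: the pressure decay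
input of `offAxisSmoothRepresentative_of` is the theorem `seregin_sverak_pressure_decay_holds`.
[cite: SereginSverak2009, §2 p. 8 with Remark 3.4; mechanism Seregin2014 Ch. 6 Lemma 6.1] -/
theorem offAxisSmoothRepresentative_of_lemma61 (h61 : seregin2014_lemma61) :
    OffAxisSmoothRepresentative :=
  offAxisSmoothRepresentative_of seregin_sverak_pressure_decay_holds h61

/-- **(as15) from Prop. 4.1 and Lemma 6.1**: the reduction `unitScaleOffAxisBound_of_offAxisSupBound`
with its smoothness input discharged by `offAxisSmoothRepresentative_of_lemma61`.
[cite: SereginSverak2009, proof of Prop. 3.7, (as15) (arXiv p. 10)] -/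
theorem unitScaleOffAxisBound_of_offAxisSupBound_of_lemma61 (h41 : OffAxisSupBound)
    (h61 : seregin2014_lemma61) : UnitScaleOffAxisBound :=
  unitScaleOffAxisBound_of_offAxisSupBound h41 (offAxisSmoothRepresentative_of_lemma61 h61)

/-! ### The ε-regularity step of the proof of Lemma 2.3, from Lemma 6.1 (`k = 0`) -/

/-- **Seregin–Zajaczkowski 2007, Lemma 2.3, last step — "according to the so-called ε-regularity
theory … the latter implies … `|v(z₀)| ≤ c/r₀`" (arXiv p. 3) — from Seregin 2014, Lemma 6.1,
`k = 0`**, in the a.e. form: for a suitable weak solution on `Q(0, 3)`, a centre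
`z₀ ∈ 𝒞(1,2;1) × ]-1,0[`, a scale `0 < ρ ≤ 1/4` and the smallness `C(ρ; z₀) + D(ρ; z₀) ≤ η < ε₀`,
the pair is in the class `IsSuitableWeakSolutionInBall ρ z₀` (its closed box lies in
`Q̂ ⊆ Q(0,3)`, `closedBox_subset_shellCyl_hat`), its zoom to `Q(0,1)` satisfies (6.1.5)
(`∫_{Q(0,1)} |U|³ + |P|^{3/2} = C(ρ; z₀) + D(ρ; z₀)`), Lemma 6.1 bounds the representative by
`c₀ 0` on `Q(0, 1/2)`, and transporting back (`exists_representative_of_zoom`) gives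
`|u| ≤ c₀ 0 / ρ` a.e. on `Q_{ρ/2}(z₀)`. [cite: SereginZajaczkowski2007, proof of Lemma 2.3 (arXiv p. 3); mechanism Seregin2014 Ch. 6 Lemma 6.1 and p. 100] -/
theorem ae_bound_of_lemma61 {ε₀ : ℝ} {c₀ : ℕ → ℝ}
    (H : ∀ (U : ℝ → EuclideanSpace ℝ (Fin 3) → EuclideanSpace ℝ (Fin 3)) (P : ℝ → EuclideanSpace ℝ (Fin 3) → ℝ),
      IsSuitableWeakSolutionInBall 1 0 U P →
      ∫⁻ z in parabolicCylinder 1 (0 : ℝ × EuclideanSpace ℝ (Fin 3)),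
          (‖U z.1 z.2‖ₑ ^ (3 : ℕ) + ‖P z.1 z.2‖ₑ ^ (3 / 2 : ℝ)) < ENNReal.ofReal ε₀ →
      ∃ W : ℝ → EuclideanSpace ℝ (Fin 3) → EuclideanSpace ℝ (Fin 3),
        uncurry U =ᵐ[volume.restrict (parabolicCylinder (1 / 2) (0 : ℝ × EuclideanSpace ℝ (Fin 3)))] uncurry W ∧
        (∀ z ∈ parabolicCylinder (1 / 2) (0 : ℝ × EuclideanSpace ℝ (Fin 3)), ContDiffAt ℝ ∞ (W z.1) z.2) ∧
        ∀ k : ℕ,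
          (∃ C α : ℝ≥0, 0 < α ∧
            HolderOnWith C α (fun z : ℝ × EuclideanSpace ℝ (Fin 3) => iteratedFDeriv ℝ k (W z.1) z.2)
              (parabolicCylinder (1 / 2) (0 : ℝ × EuclideanSpace ℝ (Fin 3)))) ∧
          ∀ z ∈ parabolicCylinder (1 / 2) (0 : ℝ × EuclideanSpace ℝ (Fin 3)), ‖iteratedFDeriv ℝ k (W z.1) z.2‖ ≤ c₀ k)
    {z₀ : ℝ × EuclideanSpace ℝ (Fin 3)} (h₀ : z₀ ∈ shellCyl 1 2 1 1)
    (hsuit : IsSuitableWeakSolutionOn (parCylOpens 0 3) 1 0 u p)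
    {ρ : ℝ} (hρ : 0 < ρ) (hρ4 : ρ ≤ 1 / 4) {η : ℝ≥0∞} (hη : η < ENNReal.ofReal ε₀)
    (hsmall : cknC ρ z₀ u + cknD ρ z₀ p ≤ η) :
    ∀ᵐ w ∂(volume.restrict (parabolicCylinder (ρ / 2) z₀)), ‖u w.1 w.2‖ ≤ c₀ 0 / ρ := by
  -- the class on `Q_ρ(z₀)`: its closed box lies in `Q̂ ⊆ Q̃ ⊆ Q(0,3)`
  have hbox : Icc (z₀.1 - ρ ^ 2) z₀.1 ×ˢ closedBall z₀.2 ρ ⊆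
      (parCylOpens (0 : ℝ × EuclideanSpace ℝ (Fin 3)) 3 : Set (ℝ × EuclideanSpace ℝ (Fin 3))) := by
    refine (closedBox_subset_shellCyl_hat h₀ hρ4).trans (shellCyl_hat_subset_tilde.trans ?_)
    intro z hz
    have hz' : z ∈ outerShell 1 0 := by rw [outerShell_one_eq]; exact hz
    exact outerShell_one_subset hz'
  have hball := (hsuit.isSuitableWeakSolutionInBall hbox).zoom hρ
  -- (6.1.5) for the zoomed pair
  have hmeas : AEMeasurable (fun w : ℝ × EuclideanSpace ℝ (Fin 3) =>
      ‖(ρ • stPull (ρ ^ 2) ρ z₀.1 z₀.2 u) w.1 w.2‖ₑ ^ (3 : ℕ))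
      (volume.restrict (parabolicCylinder 1 (0 : ℝ × EuclideanSpace ℝ (Fin 3)))) :=
    (hball.1.distributional.1.aestronglyMeasurable.enorm.pow_const _)
  have hsmall' : ∫⁻ w in parabolicCylinder 1 (0 : ℝ × EuclideanSpace ℝ (Fin 3)),
      (‖(ρ • stPull (ρ ^ 2) ρ z₀.1 z₀.2 u) w.1 w.2‖ₑ ^ (3 : ℕ) +
        ‖(ρ ^ 2 • stPull (ρ ^ 2) ρ z₀.1 z₀.2 p) w.1 w.2‖ₑ ^ (3 / 2 : ℝ)) < ENNReal.ofReal ε₀ := by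
    rw [lintegral_add_left' hmeas, lintegral_cube_zoom hρ z₀ u, lintegral_pressure_zoom hρ z₀ p]
    exact hsmall.trans_lt hη
  obtain ⟨W, hW, hcd, hk⟩ := H _ _ hball hsmall'
  obtain ⟨V, hV1, -, -, hV4⟩ := exists_representative_of_zoom hρ z₀ hW hcd (fun j => (hk j).1) (fun j => (hk j).2)
  have hmem : ∀ᵐ w ∂(volume.restrict (parabolicCylinder (ρ / 2) z₀)), w ∈ parabolicCylinder (ρ / 2) z₀ :=
    ae_restrict_mem (isOpen_parabolicCylinder _ _).measurableSet
  filter_upwards [hV1, hmem] with w hw hwm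
  have hb := hV4 0 w hwm
  rw [norm_iteratedFDeriv_zero, zero_add, pow_one] at hb
  have e : u w.1 w.2 = V w.1 w.2 := by
    have := hw
    simpa only [uncurry] using this
  rw [e, div_eq_inv_mul]
  exact hb

/-! ### (as15) from Corollary 4.4 and Lemma 6.1 -/

/-- **Seregin–Šverák 2009, (as15) — `UnitScaleOffAxisBound` — from Seregin–Zajaczkowski 2007,
Cor. 4.4 and Seregin 2014, Lemma 6.1 only.** The printed proof of Prop. 3.7 / SZ2007 Prop. 4.1
("Applying Corollary 4.4 and Lemma 2.3") run exactly as in the accepted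
`unitScaleOffAxisBound_of_inputs` (`SereginSverakOffAxisEpsilon.lean`), with its three other
inputs now supplied by theorems of the tree: the smoothness of the pairs off the axis
(`offAxisSmoothRepresentative_of_lemma61`, feeding Cor. 4.4 through
`sixthPower_le_of_offAxisL6Bound`), the decay estimate for the pressure
(`seregin_sverak_pressure_decay_holds`), and the ε-regularity step, taken from Lemma 6.1 with
`k = 0` (`ae_bound_of_lemma61`) instead of Lemarié-Rieusset's Thm. 14.4. For a pair with
`𝒜₂ ≤ K` and a centre `z₀ ∈ 𝒞(1,2;1) × ]-1,0[`: the Hölder bound `C(s²; z₀) ≤ a_K s`,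
`a_K = (|B₁| Φ₆(K))^{1/2}`, at the scales `s_k = σ^k/2` (`cknC_le_of_sixth_bound`), the decay
estimate between consecutive scales (`cσ² ≤ 1/2`), the majorant `decayMajorant c σ a_K (16K)` of
`D(s_k²; z₀)`, the first index `k₀ = epsIndex c σ η a_K (16K)` with `g_{k₀} + a_K s_{k₀} ≤ η`,
`η = ε₀/2`, the bound `|u| ≤ c₀ 0 / ρ_K` a.e. on `Q_{ρ_K/2}(z₀)`, `ρ_K = s_{k₀}²`, and the
countable covering of `Q¹₁(0)` (`ae_innerShell_of_centres`). `Φ(K) = max(0, c₀ 0) / ρ_K` is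
non-decreasing because `k₀(K)` is. [cite: SereginSverak2009, proof of Prop. 3.7, (as15) (arXiv p. 10); SereginZajaczkowski2007, proof of Lemma 2.3 (p. 3) and of Prop. 4.1 (p. 7)] -/
theorem unitScaleOffAxisBound_of_lemma61 (h44 : OffAxisL6Bound) (h61 : seregin2014_lemma61) :
    UnitScaleOffAxisBound := by
  have hreg : OffAxisSmoothRepresentative := offAxisSmoothRepresentative_of_lemma61 h61
  obtain ⟨Φ₆, hΦ₆m, h6⟩ := sixthPower_le_of_offAxisL6Bound h44 hreg
  obtain ⟨c, h22⟩ := seregin_sverak_pressure_decay_holds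
  obtain ⟨ε₀, hε₀, c₀, H⟩ := h61
  obtain ⟨σ, hσ0, hσ1, hcσ⟩ := exists_ratio_sq c
  have hσR : (0 : ℝ) < σ := by exact_mod_cast hσ0
  -- the constants: `B = |B₁|`, `a_K = (B Φ₆ K)^{1/2}`, `η = ε₀/2`
  set B : ℝ≥0∞ := volume (ball (0 : EuclideanSpace ℝ (Fin 3)) 1) with hB
  have hBfin : B < ⊤ := measure_ball_lt_top
  have hafin : ∀ K : ℝ≥0, (B * (Φ₆ K : ℝ≥0∞)) ^ (2⁻¹ : ℝ) ≠ ⊤ := fun K =>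
    ENNReal.rpow_ne_top_of_nonneg (by norm_num) (ENNReal.mul_ne_top hBfin.ne ENNReal.coe_ne_top)
  set a : ℝ≥0 → ℝ≥0 := fun K => ((B * (Φ₆ K : ℝ≥0∞)) ^ (2⁻¹ : ℝ)).toNNReal with ha
  have hacoe : ∀ K, (a K : ℝ≥0∞) = (B * (Φ₆ K : ℝ≥0∞)) ^ (2⁻¹ : ℝ) := fun K =>
    ENNReal.coe_toNNReal (hafin K)
  have hamono : Monotone a := fun K K' h =>
    ENNReal.toNNReal_mono (hafin K')
      (ENNReal.rpow_le_rpow (mul_le_mul' le_rfl (ENNReal.coe_le_coe.2 (hΦ₆m h))) (by norm_num))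
  set η : ℝ≥0 := Real.toNNReal (ε₀ / 2) with hη
  have hη0 : 0 < η := Real.toNNReal_pos.2 (by positivity)
  have hηcoe : (η : ℝ≥0∞) = ENNReal.ofReal (ε₀ / 2) := rfl
  have hηlt : (η : ℝ≥0∞) < ENNReal.ofReal ε₀ := by
    rw [hηcoe]
    exact (ENNReal.ofReal_lt_ofReal_iff hε₀).2 (by linarith)
  -- the scale `ρ_K = s_{k₀(K)}²`
  set ρ : ℝ≥0 → ℝ := fun K =>
    ((epsHalfScale σ (epsIndex c σ η (a K) (16 * K)) : ℝ≥0) : ℝ) ^ 2 with hρ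
  have hρpos : ∀ K, 0 < ρ K := fun K => by
    have := (epsHalfScale_pos_sq_le hσ0 hσ1 (epsIndex c σ η (a K) (16 * K))).1
    positivity
  have hρ4 : ∀ K, ρ K ≤ 1 / 4 := fun K =>
    (epsHalfScale_pos_sq_le hσ0 hσ1 (epsIndex c σ η (a K) (16 * K))).2
  have hρanti : ∀ K K', K ≤ K' → ρ K' ≤ ρ K := by
    intro K K' hKK'
    have hk : epsIndex c σ η (a K) (16 * K) ≤ epsIndex c σ η (a K') (16 * K') :=
      epsIndex_mono c η hσ1 hη0 (hamono hKK') (mul_le_mul' le_rfl hKK')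
    have hs := epsHalfScale_antitone hσ1.le hk
    exact pow_le_pow_left₀ (NNReal.coe_nonneg _) (NNReal.coe_le_coe.2 hs) 2
  have hc₀ : 0 ≤ max 0 (c₀ 0) := le_max_left _ _
  refine ⟨fun K => ⟨max 0 (c₀ 0) / ρ K, div_nonneg hc₀ (hρpos K).le⟩, ?_, ?_⟩
  · intro K K' hKK'
    exact Subtype.mk_le_mk.2 (div_le_div_of_nonneg_left hc₀ (hρpos K') (hρanti K K' hKK'))
  intro u p h3 G hG K hK
  have hsuit := h3.isSuitable SuitableOfBounded_holds
  obtain ⟨hA, hE, -, hD⟩ := szEnergy_bounds hK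
  have h6K := h6 u p h3 G hG K hK
  have humeas : AEStronglyMeasurable (uncurry u) (volume.restrict (parCyl (0 : ℝ × EuclideanSpace ℝ (Fin 3)) 3)) :=
    h3.distributional.1.aestronglyMeasurable
  set k₀ : ℕ := epsIndex c σ η (a K) (16 * K) with hk₀
  have hsk := epsHalfScale_pos_sq_le hσ0 hσ1
  -- the bound on every cylinder `Q_{ρ/2}(z₀)`
  have hcentre : ∀ z₀ ∈ shellCyl 1 2 1 1,
      ∀ᵐ w ∂(volume.restrict (parabolicCylinder (ρ K / 2) z₀)), ‖u w.1 w.2‖ ≤ max 0 (c₀ 0) / ρ K := by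
    intro z₀ h₀
    -- the decay estimate along the scales `s_k²`, inside `Q(0, 3)`
    have h22z : ∀ k, cknD ((σ * (epsHalfScale σ k : ℝ)) ^ 2) z₀ p ≤
        c * (ENNReal.ofReal ((σ * (epsHalfScale σ k : ℝ)) ^ 2 / (epsHalfScale σ k : ℝ) ^ 2) *
          cknD ((epsHalfScale σ k : ℝ) ^ 2) z₀ p +
          ENNReal.ofReal (((epsHalfScale σ k : ℝ) ^ 2 / (σ * (epsHalfScale σ k : ℝ)) ^ 2) ^ 2) *
          cknC ((epsHalfScale σ k : ℝ) ^ 2) z₀ u) := by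
      intro k
      obtain ⟨hs0, hs4⟩ := hsk k
      have hσ1R : (σ : ℝ) ≤ 1 := by exact_mod_cast hσ1.le
      have hle : ((σ : ℝ) * (epsHalfScale σ k : ℝ)) ^ 2 ≤ (epsHalfScale σ k : ℝ) ^ 2 :=
        pow_le_pow_left₀ (by positivity) (mul_le_of_le_one_left hs0.le hσ1R) 2
      exact h22 (parCylOpens 0 3) u p h3.distributional z₀ _ _ (by positivity) hle
        ((parabolicCylinder_subset_parCyl _ _).trans (parCyl_subset_parCyl_three h₀ hs4))
    -- the Hölder bound on `C` at the scales `s_k`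
    have hCk : ∀ k, cknC (((epsHalfScale σ k : ℝ≥0) : ℝ) ^ 2) z₀ u ≤
        ((a K * epsHalfScale σ k : ℝ≥0) : ℝ≥0∞) := by
      intro k
      have := cknC_le_of_sixth_bound humeas h6K h₀ (hsk k).1 (hsk k).2
      rwa [ENNReal.ofReal_coe_nnreal, ← hacoe, ← ENNReal.coe_mul] at this
    -- `D(s_k²; z₀) ≤ g_k`
    have hDk : ∀ k, cknD (((epsHalfScale σ k : ℝ≥0) : ℝ) ^ 2) z₀ p ≤
        (decayMajorant c σ (a K) (16 * K) k : ℝ≥0∞) := by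
      intro k
      induction k with
      | zero =>
        have e0 : ((epsHalfScale σ 0 : ℝ≥0) : ℝ) ^ 2 = 1 / 4 := by
          simp [epsHalfScale]
          norm_num
        rw [e0]
        exact cknD_quarter_le_of_bound h₀ hD
      | succ k ih =>
        obtain ⟨hs0, hs4⟩ := hsk k
        set s : ℝ := ((epsHalfScale σ k : ℝ≥0) : ℝ) with hs
        have e1 : ((epsHalfScale σ (k + 1) : ℝ≥0) : ℝ) = σ * s := by
          simp [hs, epsHalfScale, pow_succ]
          ring
        have h := h22z k
        obtain ⟨e2, e3⟩ := scale_ratios hσR hs0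
        rw [e2, e3, show ENNReal.ofReal ((σ : ℝ) ^ 2) = ((σ ^ 2 : ℝ≥0) : ℝ≥0∞) by
            rw [← NNReal.coe_pow, ENNReal.ofReal_coe_nnreal],
          show ENNReal.ofReal (((σ : ℝ) ^ 4)⁻¹) = (((σ ^ 4)⁻¹ : ℝ≥0) : ℝ≥0∞) by
            rw [← NNReal.coe_pow, ← NNReal.coe_inv, ENNReal.ofReal_coe_nnreal]] at h
        rw [e1, decayMajorant_succ]
        exact decay_step_ennreal hcσ h ih (hCk k)
    -- smallness at the scale `ρ = s_{k₀}²`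
    have hspec := epsIndex_spec c (a K) (16 * K) hσ1 hη0
    have hCD : cknC (ρ K) z₀ u + cknD (ρ K) z₀ p ≤ η :=
      calc cknC (ρ K) z₀ u + cknD (ρ K) z₀ p
          ≤ ((a K * epsHalfScale σ k₀ : ℝ≥0) : ℝ≥0∞) + (decayMajorant c σ (a K) (16 * K) k₀ : ℝ≥0∞) :=
            add_le_add (hCk k₀) (hDk k₀)
        _ ≤ η := by rw [add_comm]; exact_mod_cast hspec
    have hbd := ae_bound_of_lemma61 H h₀ hsuit (hρpos K) (hρ4 K) hηlt hCD
    filter_upwards [hbd] with w hw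
    exact hw.trans (div_le_div_of_nonneg_right (le_max_right _ _) (hρpos K).le)
  exact ae_innerShell_of_centres (P := fun w => ‖u w.1 w.2‖ ≤ max 0 (c₀ 0) / ρ K) (hρpos K) hcentre

/-- **Seregin–Šverák 2009, (as14) — `OffAxisBound` — from Cor. 4.4 and Lemma 6.1**, through the
accepted inverse scaling `offAxisBound_of_unitScaleOffAxisBound`.
[cite: SereginSverak2009, proof of Prop. 3.7, (as14)–(as15) (arXiv p. 10)] -/
theorem offAxisBound_of_lemma61 (h44 : OffAxisL6Bound) (h61 : seregin2014_lemma61) : OffAxisBound :=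
  offAxisBound_of_unitScaleOffAxisBound (unitScaleOffAxisBound_of_lemma61 h44 h61)

/-- **Seregin–Šverák 2009, Proposition 3.7 — `AxisDecayBound` — from Lemma 3.5
(`ScaledEnergyBound`), Seregin–Zajaczkowski 2007 Cor. 4.4 (`OffAxisL6Bound`) and Seregin 2014
Lemma 6.1 (`seregin2014_lemma61`)**, through the accepted covering
`axisDecayBound_of_unitScaleOffAxisBound`. [cite: SereginSverak2009, Prop. 3.7 and its proof (arXiv p. 10)] -/
theorem axisDecayBound_of_lemma61 (h35 : ScaledEnergyBound) (h44 : OffAxisL6Bound)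
    (h61 : seregin2014_lemma61) : AxisDecayBound :=
  axisDecayBound_of_unitScaleOffAxisBound h35 (unitScaleOffAxisBound_of_lemma61 h44 h61)

end SereginSverak2009

end Literature.Analysis.FluidPDE

end
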